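import Literature.NumberTheory.LFunctions.ClassGroupLFunctionRealZeros
import Literature.NumberTheory.LFunctions.UniformTwistedLogDerivBound
import Literature.NumberTheory.LFunctions.ClassicalPsiErrorTerm
import Literature.NumberTheory.LFunctions.PrimeIdealTheoremProofs
import Literature.NumberTheory.LFunctions.ClassGroupLFunctionInversion
import HarnessLib

/-!
# The prime ideal theorem for an ideal class with de la Vallée-Poussin error term (fixed field)

Topic `Literature/NumberTheory/LFunctions` (namespace `Literature.NumberTheory.LFunctions.NumberField`).
Everything here is PROVED (two definitions with bodies, one `abbrev`, theorems; no named facts).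

For a number field `K` and an ideal class `C ∈ Cl_K` let
`Λ_C(n) = h_K Σ_{N𝔞 = n, [𝔞] = C} Λ(𝔞)` (`classVonMangoldt`).  We prove

  `|Σ_{n ≤ x} Λ_C(n) − x| ≤ C' x exp(−c' √log x)`   (`x ≥ 2`)

with `c' > 0`, `C'` depending on `K` (`classVonMangoldt_psi_le`): Landau's prime ideal theorem for
ideal classes with the classical error term (Landau 1918; the field-uniform refinement is
[ThornerZaman2019, Thm. 1.4]).  This is the "prime number theorem with remainder for the primes of a
class" that the joint universality theorem for class group `L`-functions needs (Voronin 1976 /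
Karatsuba–Voronin Ch. VII §3, cf. `Literature.Barriers.RiemannHypothesis.Voronin1976_epsteinStrip`).

## Proof

By orthogonality `Σ Λ_C(n) n^{−s} = Σ_χ χ̄(C)·(−L'/L(s, χ))` (`LSeries_classVonMangoldt_eq`), the sum
over the characters of `Cl_K` (indexed by `AddChar (Additive Cl_K) ℂ` as in
`ClassGroupLFunctionInversion.lean`).  The trivial character contributes `−ζ_K'/ζ_K = 1/(s−1) + F₀`
with `F₀` controlled by the tree's `ClassicalZFRData` for Landau's continuation of `ζ_K`
(`classicalZFRData_of_isLandauContinuation`, `ClassicalZFRData.classicalPsiData`); a character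
`χ ≠ 1` contributes `−L₀'/L₀(s, χ)` for the entire `L₀(·, χ)` (`ClassGroupLFunctionEntire.lean`),
controlled in a region `σ ≥ 1 − c₁/(log|d_K| + log(|t|+4))` away from the real zeros by the
uniform zero-free region / log-derivative bound of the tree
(`uniformTwistedZFRData_classGroupLFunction₀_of_eq/_of_ne`,
`UniformTwistedZFRData.exists_logDeriv_bound_const`).  For the FIXED field we shrink the constant
below `min_χ r_χ log 4 / 2`, where `L₀(·, χ)` has no zero in `|s − 1| < r_χ` (`L₀(1, χ) ≠ 0`,
`classGroupLFunction₀_one_ne_zero`), so that every real zero (all have `Re ≤ 1`) lies at distance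
`≥ r_χ/2` from the region; this yields the hypotheses `ClassicalPsiData Λ_C F c C_b` of Landau's
method (`exists_classicalPsiData_classVonMangoldt`) and the tree's
`ClassicalPsiData.abs_psi_sub_le` (Montgomery–Vaughan Thm. 6.9) concludes.

## Main results

* `classVonMangoldt_eq_sum_addChar`, `LSeries_classVonMangoldt_eq` — orthogonality;
* `exists_classicalPsiData_classVonMangoldt` — the hypotheses of Landau's method for `Λ_C`;
* `classVonMangoldt_psi_le` — **the class prime ideal theorem with remainder** (fixed field).

## References

* E. Landau, *Über Ideale und Primideale in Idealklassen*, Math. Z. 2 (1918), 52–154.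
* J. Thorner, A. Zaman, *A unified and improved Chebotarev density theorem*, Algebra Number Theory
  13 (2019) 1039–1068, Thm. 1.4, Thm. 3.1. [ThornerZaman2019]
* H. L. Montgomery, R. C. Vaughan, *Multiplicative Number Theory I*, CUP 2007, Thm. 6.9, §11.3.
  [MontgomeryVaughan2007]
-/

noncomputable section

open scoped NumberField nonZeroDivisors
open NumberField Complex Filter Topology Set Metric
open Literature.NumberTheory.LFunctions.AbelianDensity (toMulHom toMulHom_apply)

namespace Literature.NumberTheory.LFunctions.NumberField

variable (K : Type*) [Field K] [NumberField K]

/-! ### The von Mangoldt function of an ideal class -/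

open scoped Classical in
/-- `Λ(𝔞)·[ [𝔞] = C ]` for a nonzero ideal `𝔞` (`0` on the zero ideal). [folklore] -/
def classVonMangoldtIdeal (C : ClassGroup (𝓞 K)) (I : Ideal (𝓞 K)) : ℝ :=
  if h : I = ⊥ then 0 else
    if ClassGroup.mk0 ⟨I, mem_nonZeroDivisors_of_ne_zero h⟩ = C then idealVonMangoldt I else 0

/-- **The von Mangoldt function of the class `C`, grouped by norm**:
`Λ_C(n) = h_K Σ_{N𝔞 = n, [𝔞] = C} Λ(𝔞)` (real, `≥ 0`). [cite: ThornerZaman2019, §5.1 (ψ_C)] -/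
def classVonMangoldt (C : ClassGroup (𝓞 K)) (n : ℕ) : ℝ :=
  (Fintype.card (ClassGroup (𝓞 K)) : ℝ) * ∑ I ∈ idealsOfNorm K n, classVonMangoldtIdeal K C I

variable {K}

/-- `Λ(𝔞)[ [𝔞] = C ] ≥ 0`. [folklore] -/
theorem classVonMangoldtIdeal_nonneg (C : ClassGroup (𝓞 K)) (I : Ideal (𝓞 K)) :
    0 ≤ classVonMangoldtIdeal K C I := by
  classical
  unfold classVonMangoldtIdeal
  split_ifs <;> first | exact le_rfl | exact idealVonMangoldt_nonneg I

/-- `Λ_C ≥ 0`. [folklore] -/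
theorem classVonMangoldt_nonneg (C : ClassGroup (𝓞 K)) (n : ℕ) : 0 ≤ classVonMangoldt K C n :=
  mul_nonneg (Nat.cast_nonneg _) (Finset.sum_nonneg fun I _ ↦ classVonMangoldtIdeal_nonneg C I)

/-- The character attached to an additive character `ψ` of `Additive Cl_K`. [folklore] -/
abbrev charOf (ψ : AddChar (Additive (ClassGroup (𝓞 K))) ℂ) : ClassGroup (𝓞 K) →* ℂˣ :=
  (toMulHom ψ).toHomUnits

omit [NumberField K] in
/-- `charOf ψ = 1 ↔ ψ = 0`. [folklore] -/
theorem charOf_eq_one_iff (ψ : AddChar (Additive (ClassGroup (𝓞 K))) ℂ) : charOf ψ = 1 ↔ ψ = 0 := by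
  constructor
  · intro h
    have h0 : charOf (0 : AddChar (Additive (ClassGroup (𝓞 K))) ℂ) = 1 := by
      refine MonoidHom.ext fun C ↦ Units.ext ?_
      rw [charOf, toHomUnits_toMulHom_apply]; simp
    exact toHomUnits_toMulHom_injective (h.trans h0.symm)
  · rintro rfl
    refine MonoidHom.ext fun C ↦ Units.ext ?_
    rw [charOf, toHomUnits_toMulHom_apply]; simp

/-- **Orthogonality, coefficientwise**: `Λ_C(n) = Σ_ψ ψ(C⁻¹) Λ_{χ_ψ}(n)` with
`Λ_χ(n) = Σ_{N𝔞=n} χ([𝔞])Λ(𝔞)` (`twistVonMangoldt` of `ν_χ`). [folklore] -/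
theorem classVonMangoldt_eq_sum_addChar (C : ClassGroup (𝓞 K)) (n : ℕ) :
    (classVonMangoldt K C n : ℂ) = ∑ ψ : AddChar (Additive (ClassGroup (𝓞 K))) ℂ,
      ψ (Additive.ofMul C⁻¹) * twistVonMangoldt K (classGroupCharIdealHom (charOf ψ)) n := by
  classical
  simp only [twistVonMangoldt, Finset.mul_sum, classVonMangoldt]
  rw [Finset.sum_comm]
  push_cast
  refine Finset.sum_congr rfl fun I hI ↦ ?_
  by_cases hI0 : I = ⊥
  · subst hI0
    simp [classVonMangoldtIdeal, classGroupCharIdealHom_bot]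
  · have hν : ∀ ψ : AddChar (Additive (ClassGroup (𝓞 K))) ℂ,
        classGroupCharIdealHom (charOf ψ) I =
          ψ (Additive.ofMul (ClassGroup.mk0 ⟨I, mem_nonZeroDivisors_of_ne_zero hI0⟩)) := by
      intro ψ
      rw [classGroupCharIdealHom_apply_of_ne_bot _ hI0, charOf, toHomUnits_toMulHom_apply]
    simp_rw [hν]
    have horth : ∑ ψ : AddChar (Additive (ClassGroup (𝓞 K))) ℂ, ψ (Additive.ofMul C⁻¹) *
        (ψ (Additive.ofMul (ClassGroup.mk0 ⟨I, mem_nonZeroDivisors_of_ne_zero hI0⟩)) *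
          (idealVonMangoldt I : ℂ)) =
        (if ClassGroup.mk0 ⟨I, mem_nonZeroDivisors_of_ne_zero hI0⟩ = C then
          (Fintype.card (ClassGroup (𝓞 K)) : ℂ) else 0) * (idealVonMangoldt I : ℂ) := by
      have hsum := sum_classGroupChar_apply_eq_ite (K := K)
        (C⁻¹ * ClassGroup.mk0 ⟨I, mem_nonZeroDivisors_of_ne_zero hI0⟩)
      simp_rw [← mul_assoc, ← Finset.sum_mul]
      congr 1
      rw [show (if ClassGroup.mk0 ⟨I, mem_nonZeroDivisors_of_ne_zero hI0⟩ = C then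
          (Fintype.card (ClassGroup (𝓞 K)) : ℂ) else 0) =
          (if C⁻¹ * ClassGroup.mk0 ⟨I, mem_nonZeroDivisors_of_ne_zero hI0⟩ = 1 then
            (Fintype.card (ClassGroup (𝓞 K)) : ℂ) else 0) by
        congr 1; rw [inv_mul_eq_one]; exact propext eq_comm, ← hsum]
      refine Finset.sum_congr rfl fun ψ _ ↦ ?_
      rw [ofMul_mul, AddChar.map_add_eq_mul]
    rw [horth, classVonMangoldtIdeal, dif_neg hI0]
    split_ifs with h
    · ring
    · simp

/-- **The Dirichlet series**: `Σ Λ_C(n) n^{-s} = Σ_ψ ψ(C⁻¹) L(Λ_{χ_ψ}, s)` for `Re s > 1`. [folklore] -/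
theorem LSeries_classVonMangoldt_eq (C : ClassGroup (𝓞 K)) {s : ℂ} (hs : 1 < s.re) :
    LSeries (fun n ↦ (classVonMangoldt K C n : ℂ)) s =
      ∑ ψ : AddChar (Additive (ClassGroup (𝓞 K))) ℂ, ψ (Additive.ofMul C⁻¹) *
        LSeries (twistVonMangoldt K (classGroupCharIdealHom (charOf ψ))) s := by
  have hterm : ∀ n, LSeries.term (fun n ↦ (classVonMangoldt K C n : ℂ)) s n =
      ∑ ψ : AddChar (Additive (ClassGroup (𝓞 K))) ℂ, ψ (Additive.ofMul C⁻¹) *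
        LSeries.term (twistVonMangoldt K (classGroupCharIdealHom (charOf ψ))) s n := by
    intro n
    rcases eq_or_ne n 0 with rfl | hn
    · simp
    · simp only [LSeries.term_of_ne_zero hn, classVonMangoldt_eq_sum_addChar, Finset.sum_div,
        mul_div_assoc]
  simp only [LSeries, tsum_congr hterm]
  rw [Summable.tsum_finsetSum (fun ψ _ ↦
    ((LSeriesSummable_twistVonMangoldt (ν := classGroupCharIdealHom (charOf ψ))
      (norm_classGroupCharIdealHom_le _) hs).mul_left _))]
  refine Finset.sum_congr rfl fun ψ _ ↦ ?_
  rw [tsum_mul_left]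

/-- Summability of `Σ Λ_C(n) n^{-s}` for `Re s > 1`. [folklore] -/
theorem LSeriesSummable_classVonMangoldt (C : ClassGroup (𝓞 K)) {s : ℂ} (hs : 1 < s.re) :
    LSeriesSummable (fun n ↦ (classVonMangoldt K C n : ℂ)) s := by
  have hterm : ∀ n, LSeries.term (fun n ↦ (classVonMangoldt K C n : ℂ)) s n =
      ∑ ψ : AddChar (Additive (ClassGroup (𝓞 K))) ℂ, ψ (Additive.ofMul C⁻¹) *
        LSeries.term (twistVonMangoldt K (classGroupCharIdealHom (charOf ψ))) s n := by
    intro n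
    rcases eq_or_ne n 0 with rfl | hn
    · simp
    · simp only [LSeries.term_of_ne_zero hn, classVonMangoldt_eq_sum_addChar, Finset.sum_div,
        mul_div_assoc]
  rw [LSeriesSummable, show LSeries.term (fun n ↦ (classVonMangoldt K C n : ℂ)) s =
    fun n ↦ ∑ ψ : AddChar (Additive (ClassGroup (𝓞 K))) ℂ, ψ (Additive.ofMul C⁻¹) *
      LSeries.term (twistVonMangoldt K (classGroupCharIdealHom (charOf ψ))) s n from funext hterm]
  exact summable_sum fun ψ _ ↦
    ((LSeriesSummable_twistVonMangoldt (ν := classGroupCharIdealHom (charOf ψ))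
      (norm_classGroupCharIdealHom_le _) hs).mul_left _)

/-- `‖ψ(a)‖ = 1` for an additive character of `Additive Cl_K`. [folklore] -/
theorem norm_addChar_apply (ψ : AddChar (Additive (ClassGroup (𝓞 K))) ℂ) (a : Additive (ClassGroup (𝓞 K))) :
    ‖ψ a‖ = 1 := by
  have h := norm_classGroupChar_apply (charOf ψ) (Additive.toMul a)
  rwa [charOf, toHomUnits_toMulHom_apply] at h

/-! ### The hypotheses of Landau's method for `Λ_C` -/

/-- Zeros of `L₀(·, χ)` (`χ ≠ 1`) have real part `≤ 1`. [folklore] -/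
theorem re_le_one_of_classGroupLFunction₀_eq_zero {χ : ClassGroup (𝓞 K) →* ℂˣ} (hχ : χ ≠ 1)
    {ρ : ℂ} (hρ : classGroupLFunction₀ K χ ρ = 0) : ρ.re ≤ 1 := by
  by_cases h1 : ρ = 1
  · rw [h1, Complex.one_re]
  · rw [classGroupLFunction₀_eq χ h1 hχ] at hρ
    have hZ : classTwistedZeta₁ K (fun C ↦ (χ C : ℂ)) ρ = 0 := by
      rw [← sub_one_mul_classGroupLFunction χ h1, hρ, mul_zero]
    exact re_le_one_of_classTwistedZeta₁_eq_zero χ hZ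

set_option maxHeartbeats 1600000 in
/-- **`Λ_C` satisfies the hypotheses of Landau's method** (`Literature.ClassicalPsiData`), for every
number field `K` and every ideal class `C`: `Σ Λ_C(n)n^{−s} = 1/(s−1) + F_C(s)` with
`F_C = F₀ + Σ_{χ≠1} χ̄(C)·(−L₀'/L₀(·, χ))`, `F₀ = −ζ_K'/ζ_K − 1/(s−1)` (Landau's continuation,
`ClassicalZFRData.classicalPsiData`), `F_C` holomorphic with `|F_C| ≪ log(|t|+4)` on a classical
region `σ > 1 − c/log(|t|+4)`: the zero-free regions of the class group `L`-functions
(`uniformTwistedZFRData_classGroupLFunction₀_of_eq/_of_ne`, `UniformTwistedZFRData.exists_logDeriv_bound_const`)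
with `c` shrunk, for this FIXED field, below `min_χ r_χ` where `L₀(·,χ)` has no zero in
`|s − 1| < r_χ` (`L₀(1, χ) ≠ 0`), so that every real zero lies at distance `≥ r_χ/2`.
[cite: ThornerZaman2019, Theorem 3.1 and §5.1 (fixed-field consequence)] -/
theorem exists_classicalPsiData_classVonMangoldt (C : ClassGroup (𝓞 K)) :
    ∃ (F : ℂ → ℂ) (c Cb : ℝ), ClassicalPsiData (classVonMangoldt K C) F c Cb := by
  classical
  -- ### the `ζ_K`-part
  obtain ⟨G₀, hG₀, hG₀1, hgr⟩ := exists_isLandauContinuation_holds K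
  have hZ := classicalZFRData_of_isLandauContinuation hG₀ hG₀1 hgr
  obtain ⟨c₀, C₀, hP₀⟩ := hZ.classicalPsiData
  set F₀ : ℂ → ℂ := fun s ↦ -(deriv G₀ s / G₀ s) with hF₀
  -- ### the characters `χ ≠ 1`: one set of constants for all packages
  set n : ℕ := Module.finrank ℚ K with hn
  obtain ⟨hA, hCg, hc₁, hK₀, hC₂⟩ := zfrParams_nonneg n
  obtain ⟨c₁, hc₁pos, C₁, hC₁0, -, hlog⟩ :=
    UniformTwistedZFRData.exists_logDeriv_bound_const (η := 1) (A := (n : ℝ) + 1)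
      (Cg := 2 * Real.exp (2 * n) * (3 / 2) ^ (n + 1)) (c₁ := 32 * Real.exp (-(32 * n)))
      (K₀ := 77760 * (5 * n + 2)) (C₂ := 77760 * (5 * n + 2) + 1) one_pos le_rfl hA hK₀ hC₂
  set Q : ℝ := ((discr K).natAbs : ℝ) with hQ
  set ℒ₀ : ℝ := Real.log Q + Real.log 4 with hℒ₀
  have hQ1 : 1 ≤ Q := by
    rw [hQ]; exact_mod_cast Int.natAbs_pos.mpr (NumberField.discr_ne_zero K)
  have hℒ₀1 : 1 ≤ ℒ₀ := UniformTwistedZFRData.log_add_log_four_ge hQ1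
  have hlog4 : 0 < Real.log 4 := Real.log_pos (by norm_num)
  -- the log-derivative bound for a character `χ ≠ 1`, in usable form
  have hpack : ∀ χ : ClassGroup (𝓞 K) →* ℂˣ, χ ≠ 1 → ∀ (s : ℂ) (d : ℝ), 0 < d → d ≤ 1 →
      1 - c₁ / (Real.log Q + Real.log (|s.im| + 4)) ≤ s.re →
      (∀ a : ℂ, classGroupLFunction₀ K χ a = 0 → a.im = 0 → 1 - 2 * c₁ / ℒ₀ < a.re → d ≤ ‖s - a‖) →
      classGroupLFunction₀ K χ s ≠ 0 ∧
        ‖deriv (classGroupLFunction₀ K χ) s / classGroupLFunction₀ K χ s‖ ≤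
          C₁ * (ℒ₀ ^ 3 / d) * Real.log (|s.im| + 4) := by
    intro χ hχ s d hd hd1 hs hdist
    by_cases h2 : χ * χ = 1
    · exact hlog _ _ _ _ _ _ (by exact_mod_cast uniformTwistedZFRData_classGroupLFunction₀_of_eq hχ h2)
        s d hd hd1 hs hdist
    · exact hlog _ _ _ _ _ _ (by exact_mod_cast uniformTwistedZFRData_classGroupLFunction₀_of_ne h2)
        s d hd hd1 hs hdist
  -- ### the radii `r_ψ`: no zero of `L₀(·, χ_ψ)` in `|s − 1| < r_ψ` (`ψ ≠ 0`)
  have hrad : ∀ ψ : AddChar (Additive (ClassGroup (𝓞 K))) ℂ, ψ ≠ 0 → ∃ r : ℝ, 0 < r ∧ r ≤ 1 ∧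
      ∀ z : ℂ, ‖z - 1‖ < r → classGroupLFunction₀ K (charOf ψ) z ≠ 0 := by
    intro ψ hψ
    have hχ : charOf ψ ≠ 1 := fun h ↦ hψ ((charOf_eq_one_iff ψ).1 h)
    have hcont : ContinuousAt (classGroupLFunction₀ K (charOf ψ)) 1 :=
      (differentiable_classGroupLFunction₀ (charOf ψ) 1).continuousAt
    have hne := classGroupLFunction₀_one_ne_zero (K := K) hχ
    have hev : ∀ᶠ z in 𝓝 (1 : ℂ), classGroupLFunction₀ K (charOf ψ) z ≠ 0 := hcont.eventually_ne hne
    obtain ⟨r, hr, hball⟩ := Metric.eventually_nhds_iff.1 hev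
    refine ⟨min r 1, lt_min hr one_pos, min_le_right _ _, fun z hz ↦ hball ?_⟩
    rw [dist_eq_norm]; exact lt_of_lt_of_le hz (min_le_left _ _)
  choose! rad hrad0 hrad1 hradZ using hrad
  -- ### the allowance `e ψ` and the region constant `c`
  set e : AddChar (Additive (ClassGroup (𝓞 K))) ℂ → ℝ := fun ψ ↦
    if ψ = 0 then 1 else min (c₁ * Real.log 4 / ℒ₀) (rad ψ * Real.log 4 / 2) with he
  have he0 : ∀ ψ, 0 < e ψ := by
    intro ψ
    simp only [he]
    split_ifs with hψ
    · exact one_pos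
    · exact lt_min (by positivity) (by have := hrad0 ψ hψ; positivity)
  have huniv : (Finset.univ : Finset (AddChar (Additive (ClassGroup (𝓞 K))) ℂ)).Nonempty :=
    ⟨0, Finset.mem_univ _⟩
  set m : ℝ := Finset.univ.inf' huniv e with hm
  have hm0 : 0 < m := by
    rw [hm, Finset.lt_inf'_iff]; exact fun ψ _ ↦ he0 ψ
  have hmle : ∀ ψ, m ≤ e ψ := fun ψ ↦ Finset.inf'_le _ (Finset.mem_univ ψ)
  set c : ℝ := min c₀ m with hc
  have hcpos : 0 < c := lt_min hP₀.c_pos hm0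
  have hcc₀ : c ≤ c₀ := min_le_left _ _
  have hcm : c ≤ m := min_le_right _ _
  -- consequences of `Re s > 1 − c/log(|t|+4)` for a character `ψ ≠ 0`
  have hregion : ∀ ψ : AddChar (Additive (ClassGroup (𝓞 K))) ℂ, ψ ≠ 0 → ∀ s : ℂ,
      1 - c / Real.log (|s.im| + 4) < s.re →
      (1 - c₁ / (Real.log Q + Real.log (|s.im| + 4)) ≤ s.re) ∧
      (∀ a : ℂ, classGroupLFunction₀ K (charOf ψ) a = 0 → a.im = 0 → 1 - 2 * c₁ / ℒ₀ < a.re →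
        rad ψ / 2 ≤ ‖s - a‖) := by
    intro ψ hψ s hs
    have hχ : charOf ψ ≠ 1 := fun h ↦ hψ ((charOf_eq_one_iff ψ).1 h)
    have heψ : e ψ = min (c₁ * Real.log 4 / ℒ₀) (rad ψ * Real.log 4 / 2) := by
      simp only [he, if_neg hψ]
    have hc1 : c ≤ c₁ * Real.log 4 / ℒ₀ := (hcm.trans (hmle ψ)).trans (by rw [heψ]; exact min_le_left _ _)
    have hc2 : c ≤ rad ψ * Real.log 4 / 2 := (hcm.trans (hmle ψ)).trans (by rw [heψ]; exact min_le_right _ _)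
    set L : ℝ := Real.log (|s.im| + 4) with hL
    have hL4 : Real.log 4 ≤ L := Real.log_le_log (by norm_num) (by linarith [abs_nonneg s.im])
    have hL0 : 0 < L := lt_of_lt_of_le hlog4 hL4
    have hQ0 : 0 ≤ Real.log Q := Real.log_nonneg hQ1
    have hℒ₀pos : 0 < ℒ₀ := by linarith
    constructor
    · -- `c/L ≤ c₁/(log Q + L)`, from `c ℒ₀ ≤ c₁ log 4` and `L ≥ log 4`
      have h2 : c * ℒ₀ ≤ c₁ * Real.log 4 := by
        rwa [le_div_iff₀ hℒ₀pos] at hc1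
      have h1 : c / L ≤ c₁ / (Real.log Q + L) := by
        rw [div_le_div_iff₀ hL0 (by linarith)]
        -- `c (log Q + L) ≤ c₁ L` since `c log Q · log 4 ≤ (c₁ log 4 − c log 4) log 4 ≤ (c₁ − c) L log 4`
        have hcc₁ : c ≤ c₁ := by
          have : c * ℒ₀ ≥ c * Real.log 4 := by rw [hℒ₀]; nlinarith [hcpos.le, hQ0]
          nlinarith
        have h3 : c * Real.log Q ≤ (c₁ - c) * Real.log 4 := by
          have : c * ℒ₀ = c * Real.log Q + c * Real.log 4 := by rw [hℒ₀]; ring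
          nlinarith
        have h4 : (c₁ - c) * Real.log 4 ≤ (c₁ - c) * L := mul_le_mul_of_nonneg_left hL4 (by linarith)
        nlinarith
      linarith
    · intro a ha haim _
      have hare : a.re ≤ 1 := re_le_one_of_classGroupLFunction₀_eq_zero hχ ha
      have hnot : ¬ ‖a - 1‖ < rad ψ := fun h ↦ hradZ ψ hψ a h ha
      push Not at hnot
      -- `a` is real: `‖a - 1‖ = 1 - a.re`
      have hreal : ‖a - 1‖ = 1 - a.re := by
        have : a - 1 = ((a.re - 1 : ℝ) : ℂ) := by
          apply Complex.ext <;> simp [haim]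
        rw [this, Complex.norm_real, Real.norm_eq_abs, abs_of_nonpos (by linarith)]; ring
      rw [hreal] at hnot
      have hsre : 1 - rad ψ / 2 < s.re := by
        have : c / L ≤ rad ψ / 2 := by
          rw [div_le_iff₀ hL0]
          calc c ≤ rad ψ * Real.log 4 / 2 := hc2
            _ ≤ rad ψ / 2 * L := by nlinarith [hrad0 ψ hψ]
        linarith
      calc rad ψ / 2 ≤ s.re - a.re := by linarith
        _ = (s - a).re := by simp
        _ ≤ |(s - a).re| := le_abs_self _
        _ ≤ ‖s - a‖ := Complex.abs_re_le_norm _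
  -- ### the function `F` and the constant `Cb`
  set coef : AddChar (Additive (ClassGroup (𝓞 K))) ℂ → ℂ := fun ψ ↦ ψ (Additive.ofMul C⁻¹) with hcoef
  set F : ℂ → ℂ := fun s ↦ F₀ s + ∑ ψ ∈ Finset.univ.erase 0, coef ψ *
    (-(deriv (classGroupLFunction₀ K (charOf ψ)) s / classGroupLFunction₀ K (charOf ψ) s)) with hF
  set Cb : ℝ := C₀ + ∑ ψ ∈ (Finset.univ.erase (0 : AddChar (Additive (ClassGroup (𝓞 K))) ℂ)),
    C₁ * (ℒ₀ ^ 3 / (rad ψ / 2)) with hCb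
  have hψ0 : ∀ ψ ∈ (Finset.univ.erase (0 : AddChar (Additive (ClassGroup (𝓞 K))) ℂ)), ψ ≠ 0 :=
    fun ψ hψ ↦ (Finset.mem_erase.1 hψ).1
  have hψne : ∀ ψ ∈ (Finset.univ.erase (0 : AddChar (Additive (ClassGroup (𝓞 K))) ℂ)),
      charOf ψ ≠ 1 := fun ψ hψ h ↦ (Finset.mem_erase.1 hψ).1 ((charOf_eq_one_iff ψ).1 h)
  refine ⟨F, c, Cb, ?_⟩
  refine
    { c_pos := hcpos
      nonneg := classVonMangoldt_nonneg C
      summable := fun s hs ↦ LSeriesSummable_classVonMangoldt C hs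
      eq := fun s hs ↦ ?_
      differentiableOn := ?_
      bound := fun s hs ↦ ?_ }
  · -- the Dirichlet series identity
    have hν0 : classGroupCharIdealHom (charOf (0 : AddChar (Additive (ClassGroup (𝓞 K))) ℂ)) =
        trivialChar K := by
      rw [(charOf_eq_one_iff 0).2 rfl, classGroupCharIdealHom_one]
    have hmain : (0 : AddChar (Additive (ClassGroup (𝓞 K))) ℂ) (Additive.ofMul C⁻¹) *
        LSeries (twistVonMangoldt K (classGroupCharIdealHom (charOf 0))) s = 1 / (s - 1) + F₀ s := by
      rw [hν0, show ((0 : AddChar (Additive (ClassGroup (𝓞 K))) ℂ) (Additive.ofMul C⁻¹)) = 1 by simp,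
        one_mul]
      have h1 : LSeries (twistVonMangoldt K (trivialChar K)) s =
          LSeries (fun n ↦ (vonMangoldtNorm K n : ℂ)) s :=
        LSeries_congr (fun _ ↦ twistVonMangoldt_trivialChar _) s
      rw [h1, LSeries_vonMangoldtNorm_eq hs, hP₀.eq s hs]
    have hsumErase : ∑ ψ ∈ Finset.univ.erase 0, ψ (Additive.ofMul C⁻¹) *
        LSeries (twistVonMangoldt K (classGroupCharIdealHom (charOf ψ))) s =
        ∑ ψ ∈ Finset.univ.erase 0, coef ψ *
          (-(deriv (classGroupLFunction₀ K (charOf ψ)) s / classGroupLFunction₀ K (charOf ψ) s)) :=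
      Finset.sum_congr rfl fun ψ hψ ↦ by
        rw [hcoef, logDeriv_classGroupLFunction₀_eq (hψne ψ hψ) hs, neg_neg]
    rw [LSeries_classVonMangoldt_eq C hs, ← Finset.add_sum_erase _ _ (Finset.mem_univ 0), hmain, hsumErase,
      hF, add_assoc]
  · -- holomorphy on the region
    intro s hs
    have hs' : 1 - c₀ / Real.log (|s.im| + 4) < s.re := by
      have : c / Real.log (|s.im| + 4) ≤ c₀ / Real.log (|s.im| + 4) :=
        div_le_div_of_nonneg_right hcc₀ (ClassicalZFRData.log_tau_pos _).le
      simp only [Set.mem_setOf_eq] at hs; linarith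
    have hF₀d : DifferentiableWithinAt ℂ F₀ {s : ℂ | 1 - c / Real.log (|s.im| + 4) < s.re} s :=
      (hP₀.differentiableOn s hs').mono (fun z hz ↦ by
        have : c / Real.log (|z.im| + 4) ≤ c₀ / Real.log (|z.im| + 4) :=
          div_le_div_of_nonneg_right hcc₀ (ClassicalZFRData.log_tau_pos _).le
        simp only [Set.mem_setOf_eq] at hz ⊢; linarith)
    simp only [hF]
    refine hF₀d.add (DifferentiableWithinAt.fun_sum fun ψ hψ ↦ ?_)
    refine (DifferentiableAt.differentiableWithinAt ?_)
    have hχ := hψne ψ hψ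
    obtain ⟨hreg, hdist⟩ := hregion ψ (hψ0 ψ hψ) s hs
    have hne := (hpack (charOf ψ) hχ s (rad ψ / 2) (by have := hrad0 ψ (hψ0 ψ hψ); positivity)
      (by have := hrad1 ψ (hψ0 ψ hψ); linarith) hreg hdist).1
    have hLd := differentiable_classGroupLFunction₀ (K := K) (charOf ψ)
    have hderiv : DifferentiableAt ℂ (deriv (classGroupLFunction₀ K (charOf ψ))) s :=
      ((hLd.analyticAt s).deriv).differentiableAt
    exact (differentiableAt_const _).mul ((hderiv.div (hLd s) hne).neg)
  · -- the bound
    have hs' : 1 - c₀ / Real.log (|s.im| + 4) < s.re := by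
      have : c / Real.log (|s.im| + 4) ≤ c₀ / Real.log (|s.im| + 4) :=
        div_le_div_of_nonneg_right hcc₀ (ClassicalZFRData.log_tau_pos _).le
      linarith
    have hL0 : 0 ≤ Real.log (|s.im| + 4) := (ClassicalZFRData.log_tau_pos _).le
    have hF₀b := hP₀.bound s hs'
    have hterm : ∀ ψ ∈ (Finset.univ.erase (0 : AddChar (Additive (ClassGroup (𝓞 K))) ℂ)),
        ‖coef ψ * (-(deriv (classGroupLFunction₀ K (charOf ψ)) s / classGroupLFunction₀ K (charOf ψ) s))‖ ≤
          C₁ * (ℒ₀ ^ 3 / (rad ψ / 2)) * Real.log (|s.im| + 4) := by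
      intro ψ hψ
      have hχ := hψne ψ hψ
      obtain ⟨hreg, hdist⟩ := hregion ψ (hψ0 ψ hψ) s hs
      have hb := (hpack (charOf ψ) hχ s (rad ψ / 2) (by have := hrad0 ψ (hψ0 ψ hψ); positivity)
        (by have := hrad1 ψ (hψ0 ψ hψ); linarith) hreg hdist).2
      rw [norm_mul, norm_neg, hcoef, norm_addChar_apply, one_mul]
      exact hb
    calc ‖F s‖ ≤ ‖F₀ s‖ + ∑ ψ ∈ Finset.univ.erase 0, ‖coef ψ *
          (-(deriv (classGroupLFunction₀ K (charOf ψ)) s / classGroupLFunction₀ K (charOf ψ) s))‖ := by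
          simp only [hF]; exact (norm_add_le _ _).trans (by gcongr; exact norm_sum_le _ _)
      _ ≤ C₀ * Real.log (|s.im| + 4) + ∑ ψ ∈ Finset.univ.erase 0,
          C₁ * (ℒ₀ ^ 3 / (rad ψ / 2)) * Real.log (|s.im| + 4) :=
          add_le_add hF₀b (Finset.sum_le_sum hterm)
      _ = Cb * Real.log (|s.im| + 4) := by rw [hCb, add_mul, Finset.sum_mul]

/-- **The prime ideal theorem for an ideal class with de la Vallée-Poussin error term** (fixed
field): for every number field `K` and every ideal class `C ∈ Cl_K` there are `c' > 0` and `C'`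
with `|h_K Σ_{N𝔞 ≤ x, [𝔞] = C} Λ(𝔞) − x| ≤ C' x exp(−c' √log x)` for all `x ≥ 2` (Landau 1918;
[ThornerZaman2019, Thm. 1.4 / Thm. 5.1] is the uniform refinement). From
`exists_classicalPsiData_classVonMangoldt` by the tree's `Literature.ClassicalPsiData.abs_psi_sub_le`
(Montgomery–Vaughan Thm. 6.9). [cite: ThornerZaman2019, Theorem 1.4 (fixed-field consequence)]
[cite: MontgomeryVaughan2007, Theorem 6.9] -/
theorem classVonMangoldt_psi_le (C : ClassGroup (𝓞 K)) :
    ∃ c' : ℝ, 0 < c' ∧ ∃ C' : ℝ, ∀ x : ℝ, 2 ≤ x →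
      |(∑ n ∈ Finset.Ioc 0 ⌊x⌋₊, classVonMangoldt K C n) - x| ≤
        C' * x * Real.exp (-c' * Real.sqrt (Real.log x)) := by
  obtain ⟨F, c, Cb, h⟩ := exists_classicalPsiData_classVonMangoldt C
  exact h.abs_psi_sub_le

end Literature.NumberTheory.LFunctions.NumberField
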